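import Literature.Analysis.FluidPDE.PalasekQuantitativeAxisym
import HarnessLib

/-!
# Palasek 2021, Theorem 2: the double-logarithmic blow-up rate in the critical weighted spaces
# `‖r^{1-3/q} u‖_{L^∞_t L^q_x}` (axisymmetric, `2 < q ≤ 3`; general, `q > 3`)

Topic `Literature/Analysis/FluidPDE`; one named fact (a result in print that the tree has not
proved, `def … : Prop`, D-0014) with proved API, typed for the ns-blowup cell's profile-search
kill table (KILLSHEET-B §1 row R7, «Palasek 2021 (lnln 1/(T−t))^{α(p)} for ‖r^{1−3/p}u‖_{L^p},
2 < p ≤ 3 — (not typed)» before this file).  The companion Thm. 1 (case `q = 3`) is the tree's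
`palasek2021_axisym_quantitative_ess` (`PalasekQuantitativeAxisym.lean`), whose rendering
conventions are followed here.

S. Palasek, *Improved quantitative regularity for the Navier–Stokes equations in a scale of
critical spaces*, Arch. Ration. Mech. Anal. 242 (2021) 1479–1531 = arXiv:2101.08586, §1 pp. 3–4:

> (2) `‖r^{1-3/q} u‖_{L^∞_t L^q_x} ≤ A`, where `u` and `q` fall into one of two cases:
> (3) either `q ∈ (3, ∞)`, or `u` is axisymmetric and `q ∈ (2, 3]`. […]
> **Theorem 2.** Let `u : [0, T_*) × ℝ³ → ℝ³` be a classical solution to (1) which blows up at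
> time `t = T_*`. If `u` and `q` satisfy (3), then
> `limsup_{t↑T_*} ‖r^{1-3/q} u(t)‖_{L^q_x(ℝ³)} / (log log (1/(T_* - t)))^c = +∞`
> for a constant `c > 0` depending only on `q`.

("here `r` is not the distance to the origin, but the distance to the `x₃`-axis"; (1) is the
unforced system with `ν = 1`; p. 72: "Theorem 2 follows immediately from Theorem 1 combined with
essentially any classical blowup criterion.")

* `Palasek2021.weightedNorm q u₀` — the critical weighted norm `‖r^{1-3/q} u₀‖_{L^q(ℝ³)} ∈ [0, ∞]`.
* `palasek2021_weighted_blowup_rate` — **Theorem 2** as a named fact (both cases of (3)).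

## Rendering (never stronger than print)

The conventions of `tao_L3_blowup_rate` (Tao 2021, Thm. 1.4, the `q = 3` triple-log predecessor;
`PartialRegularity.lean`) and of `palasek2021_axisym_quantitative_ess`: "classical solution on
`[0, T_*)`" is Tao's class on every `[0, T']`, `T' < T_*` (`IsHkClassicalSolutionOn (Icc 0 T') u p`:
smooth, `ν = 1`, `f = 0`, all `‖∇ⁿu(t)‖_{L²}` bounded — a STRONGER hypothesis than the printed
"classical"); "blows up at time `T_*`" is `‖u‖_{L^∞([0,T_*) × ℝ³)} = ∞` (`¬ IsBoundedOn (Ico 0 T) u`),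
as in `tao_L3_blowup_rate`; axisymmetry is `IsAxisymmetric (u t)` at every `t ∈ [0, T_*)`; the two
cases of (3) are the disjunction `3 < q ∨ (axisymmetric)` under `2 < q` (for `q ≤ 3` it forces the
axisymmetric case, for `q > 3` it allows both, exactly as printed); the weighted norm is
`eLpNorm (fun x => cylRadius x ^ (1 - 3/q) • u₀ x) q` (`r = cylRadius`; on the axis, a null set, the
real power takes a junk value, invisible to the norm); `limsup … = +∞` is written, as in
`tao_L3_blowup_rate`, as: for every `M`, frequently as `t ↑ T_*`,
`M (log log (T_* - t)⁻¹)^c < ‖r^{1-3/q} u(t)‖_{L^q}` in `ℝ≥0∞`.  The constant `c > 0` depends on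
`q` only (`∀ q, ∃ c`).

Proved here: at `q = 3` the weight is trivial, `weightedNorm 3 u₀ = ‖u₀‖_{L³}`
(`Palasek2021.weightedNorm_three`), so Thm. 2 contains the axisymmetric `L³` double-log rate
(`palasek2021_weighted_blowup_rate.axisym_L3`), to be compared with the symmetry-free triple-log
rate `tao_L3_blowup_rate`.

## Mathlib / tree search

`lean search 'Palasek2021|weighted_blowup|2101.08586'`: Thm. 1 (`q = 3`) typed as
`palasek2021_axisym_quantitative_ess` with its reduction file; Thm. 2 absent (2026-08-26).
Reused: `IsHkClassicalSolutionOn`, `tao_L3_blowup_rate` (shape), `IsBoundedOn`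
(`PartialRegularity.lean`, `MildSolution.lean`); `IsAxisymmetric`, `cylRadius`
(`AxisymmetricEuler.lean`).

## References

* S. Palasek, Arch. Ration. Mech. Anal. 242 (2021) 1479–1531, arXiv:2101.08586: (2), (3), Thm. 2
  (pp. 3–4), last paragraph of §7 (p. 72). [`Palasek2021`]
* T. Tao, *Quantitative bounds for critically bounded solutions to the Navier–Stokes equations*,
  Proc. Sympos. Pure Math. 104 (2021), Thm. 1.4 (the tree's `tao_L3_blowup_rate`). [`Tao2021`]
-/

noncomputable section

open MeasureTheory Set Function Filter Topology TopologicalSpace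
open scoped NNReal ENNReal

namespace Literature.Analysis.FluidPDE

/-- Local notation for physical space `ℝ³ = EuclideanSpace ℝ (Fin 3)`. -/
local notation "ℝ³" => EuclideanSpace ℝ (Fin 3)

namespace Palasek2021

/-- The **critical weighted norm** `‖r^{1-3/q} u₀‖_{L^q(ℝ³)} ∈ [0, ∞]` of Palasek 2021, (2), with
`r = cylRadius` the distance to the `x₃`-axis. [cite: Palasek2021, (2)] -/
def weightedNorm (q : ℝ) (u₀ : ℝ³ → ℝ³) : ℝ≥0∞ :=
  eLpNorm (fun x => cylRadius x ^ (1 - 3 / q) • u₀ x) (ENNReal.ofReal q) volume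

/-- At the Prodi–Serrin–Ladyzhenskaya endpoint `q = 3` the weight `r^{1-3/q}` is `1` and the
weighted norm is the `L³` norm ("One noteworthy special case of Theorems 1 and 2 is when `q = 3`,
which is the famous Prodi–Serrin–Ladyzhenskaya endpoint `L^∞_t L³_x`").
[cite: Palasek2021, §1 p. 4 (the case q = 3)] -/
theorem weightedNorm_three (u₀ : ℝ³ → ℝ³) : weightedNorm 3 u₀ = eLpNorm u₀ 3 volume := by
  unfold weightedNorm
  have h : (fun x => cylRadius x ^ (1 - 3 / (3 : ℝ)) • u₀ x) = u₀ := by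
    funext x
    rw [show (1 - 3 / (3 : ℝ)) = 0 by norm_num, Real.rpow_zero, one_smul]
  rw [h, show ENNReal.ofReal (3 : ℝ) = 3 by norm_num]

end Palasek2021

open Palasek2021

/-! ### The named fact -/

/-- **Palasek 2021, Theorem 2 (double-logarithmic blow-up rate in the critical weighted spaces).**
"Let `u : [0, T_*) × ℝ³ → ℝ³` be a classical solution to (1) which blows up at time `t = T_*`. If
`u` and `q` satisfy (3) [either `q ∈ (3, ∞)`, or `u` is axisymmetric and `q ∈ (2, 3]`], then
`limsup_{t↑T_*} ‖r^{1-3/q} u(t)‖_{L^q_x(ℝ³)} / (log log (1/(T_* - t)))^c = +∞` for a constant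
`c > 0` depending only on `q`" (`ν = 1`, no force; `r` the distance to the `x₃`-axis).  Rendered
(module docstring) in Tao's class on every `[0, T']`, `T' < T_*`, with blow-up as unboundedness
on `[0, T_*) × ℝ³`, (3) as `3 < q ∨ (every slice axisymmetric)` under `2 < q`, and the norm
`Palasek2021.weightedNorm q`. [cite: Palasek2021, Thm. 2 with (2)–(3) (arXiv:2101.08586 pp. 3–4)] -/
def palasek2021_weighted_blowup_rate : Prop :=
  ∀ q : ℝ, 2 < q → ∃ c : ℝ, 0 < c ∧ ∀ (T : ℝ) (u : ℝ → ℝ³ → ℝ³) (p : ℝ → ℝ³ → ℝ), 0 < T →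
    (∀ T' ∈ Ioo 0 T, IsHkClassicalSolutionOn (Icc 0 T') u p) →
    (3 < q ∨ ∀ t ∈ Ico 0 T, IsAxisymmetric (u t)) →
    ¬ IsBoundedOn (Ico 0 T) u →
    ∀ M : ℝ, ∃ᶠ t in 𝓝[<] T,
      ENNReal.ofReal (M * Real.log (Real.log (T - t)⁻¹) ^ c) < weightedNorm q (u t)

/-! ### API -/

namespace palasek2021_weighted_blowup_rate

variable {u : ℝ → ℝ³ → ℝ³} {p : ℝ → ℝ³ → ℝ} {T : ℝ}

/-- **The axisymmetric case `2 < q ≤ 3`** of Thm. 2 (the KILLSHEET-B R7 form): at a blow-up time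
of an axisymmetric classical solution, `‖r^{1-3/q} u(t)‖_{L^q}` exceeds every multiple of
`(log log (T - t)⁻¹)^{c(q)}` frequently as `t ↑ T`. [cite: Palasek2021, Thm. 2 (axisymmetric case of (3))] -/
theorem axisym (h : palasek2021_weighted_blowup_rate) {q : ℝ} (hq : 2 < q) :
    ∃ c : ℝ, 0 < c ∧ ∀ (T : ℝ) (u : ℝ → ℝ³ → ℝ³) (p : ℝ → ℝ³ → ℝ), 0 < T →
      (∀ T' ∈ Ioo 0 T, IsHkClassicalSolutionOn (Icc 0 T') u p) →
      (∀ t ∈ Ico 0 T, IsAxisymmetric (u t)) →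
      ¬ IsBoundedOn (Ico 0 T) u →
      ∀ M : ℝ, ∃ᶠ t in 𝓝[<] T,
        ENNReal.ofReal (M * Real.log (Real.log (T - t)⁻¹) ^ c) < weightedNorm q (u t) := by
  obtain ⟨c, hc, hmain⟩ := h q hq
  exact ⟨c, hc, fun T u p hT hcl hax hunb => hmain T u p hT hcl (Or.inr hax) hunb⟩

/-- **The symmetry-free case `q > 3`** of Thm. 2. [cite: Palasek2021, Thm. 2 (case q ∈ (3, ∞) of (3))] -/
theorem general (h : palasek2021_weighted_blowup_rate) {q : ℝ} (hq : 3 < q) :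
    ∃ c : ℝ, 0 < c ∧ ∀ (T : ℝ) (u : ℝ → ℝ³ → ℝ³) (p : ℝ → ℝ³ → ℝ), 0 < T →
      (∀ T' ∈ Ioo 0 T, IsHkClassicalSolutionOn (Icc 0 T') u p) →
      ¬ IsBoundedOn (Ico 0 T) u →
      ∀ M : ℝ, ∃ᶠ t in 𝓝[<] T,
        ENNReal.ofReal (M * Real.log (Real.log (T - t)⁻¹) ^ c) < weightedNorm q (u t) := by
  obtain ⟨c, hc, hmain⟩ := h q (by linarith)
  exact ⟨c, hc, fun T u p hT hcl hunb => hmain T u p hT hcl (Or.inl hq) hunb⟩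

/-- **The axisymmetric `L³` double-log rate** (Thm. 2 at `q = 3`, "the famous
Prodi–Serrin–Ladyzhenskaya endpoint … the same result as [Tao] but with one fewer … log"): at a
blow-up time of an axisymmetric classical solution `‖u(t)‖_{L³}` exceeds every multiple of
`(log log (T - t)⁻¹)^c` frequently as `t ↑ T` — compare the symmetry-free triple-log rate
`tao_L3_blowup_rate`. [cite: Palasek2021, Thm. 2 and §1 p. 4 (case q = 3)] -/
theorem axisym_L3 (h : palasek2021_weighted_blowup_rate) :
    ∃ c : ℝ, 0 < c ∧ ∀ (T : ℝ) (u : ℝ → ℝ³ → ℝ³) (p : ℝ → ℝ³ → ℝ), 0 < T →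
      (∀ T' ∈ Ioo 0 T, IsHkClassicalSolutionOn (Icc 0 T') u p) →
      (∀ t ∈ Ico 0 T, IsAxisymmetric (u t)) →
      ¬ IsBoundedOn (Ico 0 T) u →
      ∀ M : ℝ, ∃ᶠ t in 𝓝[<] T,
        ENNReal.ofReal (M * Real.log (Real.log (T - t)⁻¹) ^ c) < eLpNorm (u t) 3 volume := by
  obtain ⟨c, hc, hmain⟩ := axisym h (q := 3) (by norm_num)
  refine ⟨c, hc, fun T u p hT hcl hax hunb M => ?_⟩
  simpa only [weightedNorm_three] using hmain T u p hT hcl hax hunb M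

end palasek2021_weighted_blowup_rate

end Literature.Analysis.FluidPDE

end
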